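import Mathlib
import HarnessLib
import Summits.ABC.ABC.Theorems.SoloBlindShapeBKnown

/-!
# `ω = 3`: the `2`-adic core — `N ≤ ord₂(a₁^{b₁} a₂^{b₂} − 1)`, `|bᵢ| log |aᵢ| ≤ 3N log 2` ⟹ `N ≤ 50000 · log p · log q`

`Summits/ABC/ABC/Theorems/SoloBlindTwoadicCore.lean`; namespace `Summit.ABC.ABC.Theorems`
(solo seat `solo-ABC-blind`, wall coordinate C1⁗(1); continues `SoloBlindShapeBKnown.lean`, whose
numerical lemmas (`fortyeight_div_log_two_pow_four_le`, `log_fifty_thousand_lt`, …) it reuses).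

In the shapes of the `{2, p, q}` atlas where the power of `2` is `c`, `c − 1` or dominates
(B: `p^l + q^m = 2ⁿ`; E: `1 + 2^k = p^l q^m`; F: `1 + p^l q^m = 2^k`; A near: `2^k + p^l = q^m`, `p^l ≤ 4^k`)
the exponent of `2` is the `2`-adic valuation of `a₁^{b₁} a₂^{b₂} − 1` with `{|a₁|, |a₂|} = {p, q}`,
AND it controls the size.  The Bugeaud–Laurent estimate for two `2`-adic logarithms (named fact
`Literature.NumberTheory.Transcendental.bugeaudLaurent1996_rat`, `g = 1`, `H₁ = log p`, `H₂ = log q`)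
bounds it by `48/(log 2)⁴ · log p · log q · (max{log b'' + log log 2 + 0.4, 10})²` with
`b'' = |b₁|/log q + |b₂|/log p ≤ 6 N log 2/(log p · log q)`: the normalised exponent is the unknown
itself, so the bound inverts to an ABSOLUTE multiple of the product of the two heights.

* `le_of_le_mul_max_log_add_sq` : the real-variable inversion;
* `twoadic_exponent_le` : the core, with slack `3N` (consumed by shape A in `SoloBlindShapeAKnown`).

Used by `SoloBlindPow2EndKnown` (E, F) and `SoloBlindShapeAKnown` (A).  Trust base: the named fact, as a
hypothesis; everything else is proved.
-/

noncomputable section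

namespace Summit.ABC.ABC.Theorems

open Real Literature.NumberTheory.Transcendental

/-- Real-variable inversion with a shifted logarithm: for `c ≤ 3`,
`X ≤ 210 · (max(log X + c, 10))²` with `X > 0` forces `X ≤ 50000`
(`210 · (log 50000 + 3)² < 41200 < 50000`, and the gap only widens beyond). [folklore] -/
theorem le_of_le_mul_max_log_add_sq {X c : ℝ} (hX : 0 < X) (hc : c ≤ 3)
    (h : X ≤ 210 * max (Real.log X + c) 10 ^ 2) : X ≤ 50000 := by
  by_contra hcon
  push Not at hcon
  rcases le_or_gt (Real.log X + c) 10 with hA | hB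
  · rw [max_eq_right hA] at h
    linarith
  · rw [max_eq_left hB.le] at h
    set u : ℝ := X / 50000 with hu
    have hu1 : 1 < u := by rw [hu, lt_div_iff₀ (by norm_num : (0:ℝ) < 50000)]; linarith
    have hu0 : 0 < u := by linarith
    have hXu : X = 50000 * u := by rw [hu]; field_simp
    set s : ℝ := Real.sqrt u with hs
    have hs0 : 0 ≤ s := Real.sqrt_nonneg u
    have hsu : s ^ 2 = u := Real.sq_sqrt hu0.le
    have hs1 : 1 < s := by
      rw [hs]
      calc (1 : ℝ) = Real.sqrt 1 := Real.sqrt_one.symm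
        _ < Real.sqrt u := Real.sqrt_lt_sqrt (by norm_num) hu1
    have hlogu : Real.log u ≤ 2 * (s - 1) := by
      have h1 : Real.log s ≤ s - 1 := Real.log_le_sub_one_of_pos (by linarith)
      have h2 : Real.log u = 2 * Real.log s := by
        rw [← hsu, Real.log_pow]; norm_num
      linarith
    have hlogX : Real.log X = Real.log 50000 + Real.log u := by
      rw [hXu, Real.log_mul (by norm_num) hu0.ne']
    have hL : Real.log X + c ≤ 14 * s := by
      have := log_fifty_thousand_lt
      nlinarith
    have hLpos : 0 ≤ Real.log X + c := by linarith
    have hsq : (Real.log X + c) ^ 2 ≤ (14 * s) ^ 2 := pow_le_pow_left₀ hLpos hL 2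
    have : X ≤ 210 * (14 * s) ^ 2 := le_trans h (by nlinarith)
    rw [hXu] at this
    nlinarith

/-- **The `2`-adic core at `ω = 3`.**  Let `p ≠ q` be odd primes, `a₁ = ±p`, `a₂ = ±q`,
`b₁, b₂ ≠ 0`, and suppose `N ≥ 1` satisfies `N ≤ ord₂(a₁^{b₁} a₂^{b₂} − 1)` together with the size
conditions `|b₁| log p ≤ 3N log 2`, `|b₂| log q ≤ 3N log 2` (the power of `2` dominates the triple
up to a bounded power).
Then, granting the Bugeaud–Laurent estimate at the prime `2` (named fact `bugeaudLaurent1996_rat`,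
`g = 1`, `H₁ = log p`, `H₂ = log q`), `N ≤ 50000 · log p · log q`: the normalised exponent
`b'' = |b₁|/log q + |b₂|/log p ≤ 6 log 2 · N/(log p log q)` is the unknown itself, so the printed
`(log b'')²` inverts to an absolute constant. [folklore] -/
theorem twoadic_exponent_le (hBL : bugeaudLaurent1996_rat) {p q : ℕ}
    (hp : p.Prime) (hq : q.Prime) (hp2 : p ≠ 2) (hq2 : q ≠ 2) (hpq : p ≠ q)
    {a₁ a₂ b₁ b₂ : ℤ} (ha₁ : a₁ = p ∨ a₁ = -p) (ha₂ : a₂ = q ∨ a₂ = -q)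
    (hb₁ : b₁ ≠ 0) (hb₂ : b₂ ≠ 0) {N : ℕ} (hN : 0 < N)
    (hv : (N : ℝ) ≤ padicValRat 2 ((a₁ : ℚ) ^ b₁ * (a₂ : ℚ) ^ b₂ - 1))
    (hs₁ : |(b₁ : ℝ)| * Real.log p ≤ 3 * N * Real.log 2)
    (hs₂ : |(b₂ : ℝ)| * Real.log q ≤ 3 * N * Real.log 2) :
    (N : ℝ) ≤ 50000 * Real.log p * Real.log q := by
  have hp3 : 3 ≤ p := by have := hp.two_le; omega
  have hq3 : 3 ≤ q := by have := hq.two_le; omega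
  have hpodd : Odd p := hp.odd_of_ne_two hp2
  have hqodd : Odd q := hq.odd_of_ne_two hq2
  -- real logs
  have hP : 1 < Real.log p := by
    have : Real.log (Real.exp 1) < Real.log p := by
      apply Real.log_lt_log (Real.exp_pos 1)
      have he : Real.exp 1 < 2.7182818286 := Real.exp_one_lt_d9
      have : (3 : ℝ) ≤ p := by exact_mod_cast hp3
      linarith
    rwa [Real.log_exp] at this
  have hQ : 1 < Real.log q := by
    have : Real.log (Real.exp 1) < Real.log q := by
      apply Real.log_lt_log (Real.exp_pos 1)
      have he : Real.exp 1 < 2.7182818286 := Real.exp_one_lt_d9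
      have : (3 : ℝ) ≤ q := by exact_mod_cast hq3
      linarith
    rwa [Real.log_exp] at this
  have hP0 : 0 < Real.log p := by linarith
  have hQ0 : 0 < Real.log q := by linarith
  have hPQ : 0 < Real.log p * Real.log q := mul_pos hP0 hQ0
  have hlog2 : 0 < Real.log 2 := Real.log_pos (by norm_num)
  have hlog2' : Real.log 2 < 0.6931471808 := Real.log_two_lt_d9
  -- |a₁| = p, |a₂| = q, both odd
  have habs₁ : |a₁| = (p : ℤ) := by rcases ha₁ with h1 | h1 <;> simp [h1]
  have habs₂ : |a₂| = (q : ℤ) := by rcases ha₂ with h2 | h2 <;> simp [h2]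
  have hpoddZ : Odd (p : ℤ) := by exact_mod_cast hpodd
  have hqoddZ : Odd (q : ℤ) := by exact_mod_cast hqodd
  have ha₁odd : Odd a₁ := by
    rcases ha₁ with h1 | h1
    · rw [h1]; exact hpoddZ
    · rw [h1]; exact hpoddZ.neg
  have ha₂odd : Odd a₂ := by
    rcases ha₂ with h2 | h2
    · rw [h2]; exact hqoddZ
    · rw [h2]; exact hqoddZ.neg
  have ha₁0 : (a₁ : ℚ) ≠ 0 := by
    have : a₁ ≠ 0 := by rintro rfl; simp at ha₁odd
    exact_mod_cast this
  have ha₂0 : (a₂ : ℚ) ≠ 0 := by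
    have : a₂ ≠ 0 := by rintro rfl; simp at ha₂odd
    exact_mod_cast this
  -- valuations at p: ord_p a₁ = 1, ord_p a₂ = 0
  haveI := Fact.mk hp
  have hva₁ : padicValRat p (a₁ : ℚ) = 1 := by
    have hself : padicValRat p (p : ℚ) = 1 := padicValRat.self hp.one_lt
    rcases ha₁ with h1 | h1
    · rw [h1]; push_cast; exact hself
    · rw [h1]; push_cast; rw [padicValRat.neg]; exact hself
  have hva₂ : padicValRat p (a₂ : ℚ) = 0 := by
    have hq' : padicValRat p (q : ℚ) = 0 := by
      rw [padicValRat.of_nat]; haveI := Fact.mk hq; exact_mod_cast padicValNat_primes hpq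
    rcases ha₂ with h2 | h2
    · rw [h2]; push_cast; exact hq'
    · rw [h2]; push_cast; rw [padicValRat.neg]; exact hq'
  -- multiplicative independence of a₁, a₂
  have hind : ∀ x y : ℤ, (a₁ : ℚ) ^ x * (a₂ : ℚ) ^ y = 1 → x = 0 ∧ y = 0 := by
    intro x y hxy
    have hval := congrArg (padicValRat p) hxy
    rw [padicValRat.mul (zpow_ne_zero x ha₁0) (zpow_ne_zero y ha₂0), padicValRat.zpow,
      padicValRat.zpow, hva₁, hva₂, padicValRat.one] at hval
    have hx : x = 0 := by simpa using hval
    subst hx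
    refine ⟨rfl, ?_⟩
    simp only [zpow_zero, one_mul] at hxy
    -- |a₂|^y = 1 with |a₂| = q > 1
    have habsq : |(a₂ : ℚ)| = (q : ℚ) := by
      rw [← Int.cast_abs, habs₂]; push_cast; rfl
    have hy : (q : ℚ) ^ y = 1 := by
      have := congrArg (fun t : ℚ => |t|) hxy
      simp only [abs_zpow, abs_one] at this
      rwa [habsq] at this
    have hq1 : (1 : ℚ) < q := by exact_mod_cast hq.one_lt
    exact (zpow_right_inj₀ (by linarith) hq1.ne') |>.mp (hy.trans (zpow_zero (q : ℚ)).symm)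
  -- heights
  have hH₁ : max (Real.log |(a₁ : ℝ)|) (Real.log 2) ≤ Real.log p := by
    have : |(a₁ : ℝ)| = (p : ℝ) := by
      rw [← Int.cast_abs, habs₁]; push_cast; rfl
    rw [this]
    apply max_le le_rfl
    exact Real.log_le_log (by norm_num) (by exact_mod_cast hp.two_le)
  have hH₂ : max (Real.log |(a₂ : ℝ)|) (Real.log 2) ≤ Real.log q := by
    have : |(a₂ : ℝ)| = (q : ℝ) := by
      rw [← Int.cast_abs, habs₂]; push_cast; rfl
    rw [this]
    apply max_le le_rfl
    exact Real.log_le_log (by norm_num) (by exact_mod_cast hq.two_le)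
  have key0 := hBL.two_odd ha₁odd ha₂odd hind hb₁ hb₂ hH₁ hH₂
  have key : (N : ℝ) ≤ 48 * Real.log p * Real.log q / Real.log 2 ^ 4 *
      max (Real.log (|(b₁ : ℝ)| / Real.log q + |(b₂ : ℝ)| / Real.log p)
        + Real.log (Real.log 2) + 0.4) (max (10 * Real.log 2) 10) ^ 2 := hv.trans key0
  have hmax10 : max (10 * Real.log 2) 10 = (10 : ℝ) := by
    apply max_eq_right; linarith
  rw [hmax10] at key
  -- X = N/(log p log q); b'' ≤ 6 log 2 · X
  set X : ℝ := (N : ℝ) / (Real.log p * Real.log q) with hXdef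
  have hN1 : (1 : ℝ) ≤ N := by exact_mod_cast hN
  have hX0 : 0 < X := by rw [hXdef]; positivity
  have hnX : (N : ℝ) = X * (Real.log p * Real.log q) := by
    rw [hXdef]; field_simp
  have hb₁pos : (0 : ℝ) < |(b₁ : ℝ)| := abs_pos.mpr (by exact_mod_cast hb₁)
  have hb₂pos : (0 : ℝ) < |(b₂ : ℝ)| := abs_pos.mpr (by exact_mod_cast hb₂)
  have hb'' : |(b₁ : ℝ)| / Real.log q + |(b₂ : ℝ)| / Real.log p ≤ 6 * Real.log 2 * X := by
    have h1 : |(b₁ : ℝ)| / Real.log q ≤ (3 * N * Real.log 2) / (Real.log p * Real.log q) := by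
      rw [div_le_div_iff₀ hQ0 hPQ]
      nlinarith
    have h2 : |(b₂ : ℝ)| / Real.log p ≤ (3 * N * Real.log 2) / (Real.log p * Real.log q) := by
      rw [div_le_div_iff₀ hP0 hPQ]
      nlinarith
    have h3 : (3 * N * Real.log 2) / (Real.log p * Real.log q) = 3 * Real.log 2 * X := by
      rw [hXdef]; ring
    linarith
  have hb''pos : 0 < |(b₁ : ℝ)| / Real.log q + |(b₂ : ℝ)| / Real.log p := by positivity
  -- log b'' + log log 2 + 0.4 ≤ log X + 2.7  (log 6 ≤ 2 log 2 + (1.5 − 1), log log 2 ≤ log 2 − 1)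
  have hA : Real.log (|(b₁ : ℝ)| / Real.log q + |(b₂ : ℝ)| / Real.log p)
      + Real.log (Real.log 2) + 0.4 ≤ Real.log X + 2.7 := by
    have h1 : Real.log (|(b₁ : ℝ)| / Real.log q + |(b₂ : ℝ)| / Real.log p)
        ≤ Real.log (6 * Real.log 2 * X) := Real.log_le_log hb''pos hb''
    have h2 : Real.log (6 * Real.log 2 * X) = Real.log 6 + Real.log (Real.log 2) + Real.log X := by
      rw [Real.log_mul (by positivity) hX0.ne', Real.log_mul (by norm_num) hlog2.ne']
    have h3 : Real.log 6 ≤ 2.6 := by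
      have e1 : Real.log 6 = Real.log 2 + Real.log 2 + Real.log 1.5 := by
        rw [show (6 : ℝ) = 2 * 2 * 1.5 by norm_num, Real.log_mul (by norm_num) (by norm_num),
          Real.log_mul (by norm_num) (by norm_num)]
      have e2 : Real.log 1.5 ≤ 1.5 - 1 := Real.log_le_sub_one_of_pos (by norm_num)
      linarith
    have h4 : Real.log (Real.log 2) ≤ Real.log 2 - 1 := Real.log_le_sub_one_of_pos hlog2
    linarith
  have hM : max (Real.log (|(b₁ : ℝ)| / Real.log q + |(b₂ : ℝ)| / Real.log p)
        + Real.log (Real.log 2) + 0.4) 10 ≤ max (Real.log X + 2.7) 10 :=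
    max_le_max hA le_rfl
  have hM0 : 0 ≤ max (Real.log (|(b₁ : ℝ)| / Real.log q + |(b₂ : ℝ)| / Real.log p)
        + Real.log (Real.log 2) + 0.4) 10 := le_trans (by norm_num) (le_max_right _ _)
  have hMsq := pow_le_pow_left₀ hM0 hM 2
  have hC := fortyeight_div_log_two_pow_four_le
  have hmain : (N : ℝ) ≤ 210 * (Real.log p * Real.log q) * max (Real.log X + 2.7) 10 ^ 2 := by
    have hrhs : 48 * Real.log p * Real.log q / Real.log 2 ^ 4 =
        (48 / Real.log 2 ^ 4) * (Real.log p * Real.log q) := by ring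
    rw [hrhs] at key
    have hnonneg : 0 ≤ max (Real.log X + 2.7) 10 ^ 2 := by positivity
    calc (N : ℝ) ≤ (48 / Real.log 2 ^ 4) * (Real.log p * Real.log q) *
          max (Real.log (|(b₁ : ℝ)| / Real.log q + |(b₂ : ℝ)| / Real.log p)
            + Real.log (Real.log 2) + 0.4) 10 ^ 2 := key
      _ ≤ (48 / Real.log 2 ^ 4) * (Real.log p * Real.log q) * max (Real.log X + 2.7) 10 ^ 2 := by
          apply mul_le_mul_of_nonneg_left hMsq; positivity
      _ ≤ 210 * (Real.log p * Real.log q) * max (Real.log X + 2.7) 10 ^ 2 := by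
          apply mul_le_mul_of_nonneg_right _ hnonneg
          apply mul_le_mul_of_nonneg_right hC hPQ.le
  have hXle : X ≤ 210 * max (Real.log X + 2.7) 10 ^ 2 := by
    rw [hnX] at hmain
    have := div_le_div_of_nonneg_right hmain hPQ.le
    have e1 : X * (Real.log p * Real.log q) / (Real.log p * Real.log q) = X := by
      field_simp
    have e2 : 210 * (Real.log p * Real.log q) * max (Real.log X + 2.7) 10 ^ 2 /
        (Real.log p * Real.log q) = 210 * max (Real.log X + 2.7) 10 ^ 2 := by
      field_simp
    rw [e1, e2] at this
    exact this
  have hX50000 := le_of_le_mul_max_log_add_sq hX0 (by norm_num) hXle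
  rw [hnX]
  nlinarith

end Summit.ABC.ABC.Theorems

end
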